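import Summits.PneNP.PneNP.Theorems.SymmetryBudgetHamCompilesFAutWf
import Summits.PneNP.PneNP.Theorems.SymmetryBudgetHamCompilesFAutNat

/-!
# Acyclicity and automorphisms of the F-side gate DAG: `stub_symmetricF_aut`
# (stub `stub_symmetricF`, obligation 4/5, line `kotzig-cutspan`;
# crux `SymmetryBudget.HamCompiles`, stmt-PneNP-10637)

The obligation `SymF.AutProps m` of `SymmetryBudgetHamCompilesFDagSem.lean` (§6): the wiring of the
F-side DAG is well founded (`SymF.fargs_acyclic`, part 1), and every budget permutation
`ρ ∈ Bud m (gOf m)`, acting on gate labels by `SymF.fmapB hρ` (relabelling every vertex index),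
satisfies the clauses of `GateDAG.IsAut` over the input map `SymA.diag ρ`:

* it is bijective (`fmapB_bijective`: `ρ⁻¹` is again a budget permutation and induces the inverse);
* it fixes every output wire (`fmapB_fout`: `ρ` maps the free part onto itself);
* it preserves gate functions (`ffn_fmapB`: `SymA.rfn_rθ` on the rank gadget, literally elsewhere);
* it carries argument lists to argument lists up to permutation (`fargs_fmapB_perm`): on the
  gadget by `SymA.map_rargs_rθ`, on the fixed-arity gates argument by argument (the naturality
  lemmas of part 2, `SymmetryBudgetHamCompilesFAutNat.lean`), and on the orbit-indexed tower
  nodes `tw τ B` (one wire per vertex `w`) up to the permutation `ρ` of the index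
  (`Equiv.Perm.ofFn_comp_perm`, the pattern of `SymA.rargs_rθ`).
-/

-- `Summit.PneNP.PneNP.…` duplicates `PneNP` BY DESIGN (single-problem summit, D-0017).
set_option linter.dupNamespace false

noncomputable section

namespace Summit.PneNP.PneNP.Theorems.HamCompilesKC

open Literature.Computability.Complexity
open Finset

namespace SymF

variable {m : ℕ}

section Budget

variable {ρ : Equiv.Perm (Fin m)} (hρ : ρ ∈ Bud m (gOf m))

set_option hygiene false in
/-- The relabelling of wires by the budget permutation `ρ` (notation). -/
local notation "θ̂" => Sum.map (SymA.diag ρ) (fmapB hρ)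

set_option hygiene false in
/-- The relabelling of subsets of the free part by `ρ` (notation). -/
local notation "pmapρ" => pmap (⇑ρ) (Equiv.injective ρ) (bud_mem_freeSet hρ)

set_option hygiene false in
/-- The relabelling of tower contexts by `ρ` (notation). -/
local notation "tmapρ" => tmap (⇑ρ) (Equiv.injective ρ) (bud_mem_freeSet hρ)

/-! ### Bijectivity -/

include hρ in
/-- The inverse of a budget permutation is a budget permutation. -/
theorem symm_mem_bud : ρ.symm ∈ Bud m (gOf m) :=
  (mem_pointStabiliserBudget_iff ρ.symm).2 fun i hi =>
    ρ.injective (by rw [Equiv.apply_symm_apply, (mem_pointStabiliserBudget_iff ρ).1 hρ i hi])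

/-- `fmapB` of `ρ⁻¹` is a left inverse of `fmapB` of `ρ`. -/
theorem fmapB_symm_fmapB (l : FΛ m) : fmapB (symm_mem_bud hρ) (fmapB hρ l) = l := by
  cases l with
  | inl l =>
    refine congrArg Sum.inl ?_
    show SymA.rmap ρ.symm (SymA.rmap ρ l) = l
    rw [SymA.rmap_rmap, Equiv.symm_comp_self, SymA.rmap_id]
  | inr g => exact congrArg Sum.inr (gmap_gmap (fun u => ρ.symm_apply_apply u) g)

/-- `fmapB` of `ρ⁻¹` is a right inverse of `fmapB` of `ρ`. -/
theorem fmapB_fmapB_symm (l : FΛ m) : fmapB hρ (fmapB (symm_mem_bud hρ) l) = l := by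
  cases l with
  | inl l =>
    refine congrArg Sum.inl ?_
    show SymA.rmap ρ (SymA.rmap ρ.symm l) = l
    rw [SymA.rmap_rmap, Equiv.self_comp_symm, SymA.rmap_id]
  | inr g => exact congrArg Sum.inr (gmap_gmap (fun u => ρ.apply_symm_apply u) g)

/-- **The relabelling by a budget permutation is a bijection of the gate labels.** -/
theorem fmapB_bijective : Function.Bijective (fmapB hρ) :=
  Function.bijective_iff_has_inverse.2
    ⟨fmapB (symm_mem_bud hρ), fmapB_symm_fmapB hρ, fmapB_fmapB_symm hρ⟩

/-! ### Output wires and gate functions -/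

/-- **Every output wire is fixed.** -/
theorem fmapB_fout (i : FIdx m) : (fout m i).map (SymA.diag ρ) (fmapB hρ) = fout m i := by
  unfold fout
  split_ifs with hv
  · rw [fmapB_cTab, pmap_top hρ]
  · rfl

/-- **Gate functions are preserved.** -/
theorem ffn_fmapB (l : FΛ m) : ffn m (fmapB hρ l) = ffn m l := by
  cases l with
  | inl l => exact SymA.rfn_rθ hρ l
  | inr g => cases g <;> rfl

/-! ### Argument lists -/

/-- A guarded wire is natural when its guard and its branches are. -/
theorem fmapB_ite {p q : Prop} [Decidable p] [Decidable q] {a b a' b' : FW m} (hpq : p ↔ q)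
    (ha : θ̂ a = a') (hb : θ̂ b = b') : θ̂ (if p then a else b) = if q then a' else b' := by
  rw [apply_ite θ̂]
  exact ite_congr (propext hpq) (fun _ => ha) (fun _ => hb)

/-- **Argument lists are carried to argument lists up to permutation.** -/
theorem fargs_fmapB_perm (l : FΛ m) :
    (List.ofFn (fargs (fmapB hρ l))).Perm ((List.ofFn (fargs l)).map θ̂) := by
  cases l with
  | inl l => exact SymA.map_rargs_rθ hρ Sum.inl (fmapB hρ) (fun _ => rfl) l
  | inr g =>
    rw [List.map_ofFn]
    cases g with
    | zero => exact SymA.perm_ofFn_of_eq fun j => j.elim0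
    | one => exact SymA.perm_ofFn_of_eq fun j => j.elim0
    | unitC e c c' => exact SymA.perm_ofFn_of_eq fun j => j.elim0
    | ob P t i e c c' =>
      refine SymA.perm_ofFn_of_eq (Fin.cases rfl (Fin.cases ?_ (fun j => j.elim0)))
      symm
      show θ̂ (if t ∈ P.1 then cTab (P.erase t) e c c' else zeroW) =
        if ρ t ∈ (pmapρ P).1 then cTab ((pmapρ P).erase (ρ t)) e c c' else zeroW
      refine fmapB_ite hρ (mem_pmap_iff P t).symm ?_ rfl
      rw [fmapB_cTab, pmap_erase]
    | tw τ B c c' =>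
      let G : Fin m → FW m := fun w =>
        if w ∈ (pmapρ B).1 then chOut (.tw (tmapρ τ) (pmapρ B) w) c c' else zeroW
      have h1 : List.ofFn (fargs (fmapB hρ (Sum.inr (FG.tw τ B c c')))) = List.ofFn G := rfl
      have h2 : List.ofFn (θ̂ ∘ fargs (Sum.inr (FG.tw τ B c c') : FΛ m)) = List.ofFn (G ∘ ρ) := by
        refine congrArg List.ofFn (funext fun w => ?_)
        show θ̂ (if w ∈ B.1 then chOut (.tw τ B w) c c' else zeroW) =
          if ρ w ∈ (pmapρ B).1 then chOut (.tw (tmapρ τ) (pmapρ B) (ρ w)) c c' else zeroW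
        exact fmapB_ite hρ (mem_pmap_iff B w).symm rfl rfl
      rw [h1, h2]
      exact (Equiv.Perm.ofFn_comp_perm ρ G).symm
    | rowO P t i e w k c' =>
      refine SymA.perm_ofFn_of_eq (Fin.cases rfl (Fin.cases ?_ (fun j => j.elim0)))
      symm
      show θ̂ (if t ∈ P.1 then oTab (P.erase t) w i e (kc k) c' else zeroW) =
        if ρ t ∈ (pmapρ P).1 then oTab ((pmapρ P).erase (ρ t)) (ρ w) i e (kc k) c' else zeroW
      refine fmapB_ite hρ (mem_pmap_iff P t).symm ?_ rfl
      rw [fmapB_oTab, pmap_erase]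
    | rowI P e t r k c' =>
      refine SymA.perm_ofFn_of_eq (Fin.cases rfl (Fin.cases ?_ (fun j => j.elim0)))
      exact (fmapB_oTab hρ P t _ _ (kc k) c').symm
    | blk χ k κ => exact SymA.perm_ofFn_of_eq fun a => (bargs_natural m ρ hρ χ k κ a).symm

end Budget

end SymF

/-- **stub_symmetricF_aut** (obligation 4/5 of stub `stub_symmetricF`, line `kotzig-cutspan`,
registered on crux stmt-PneNP-10637): the wiring of the F-side DAG is acyclic, and every budget
permutation `ρ ∈ Bud m (gOf m)` acts on its gate labels (`SymF.fmapB`) as an automorphism over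
`ρ × ρ` — bijective, fixing the output wires, preserving gate functions, and permuting-and-
relabelling argument lists (the clauses of `GateDAG.IsAut`). -/
theorem stub_symmetricF_aut (m : ℕ) : SymF.AutProps m :=
  ⟨SymF.fargs_acyclic m, fun _ hρ =>
    ⟨SymF.fmapB_bijective hρ, SymF.fmapB_fout hρ, SymF.ffn_fmapB hρ, SymF.fargs_fmapB_perm hρ⟩⟩

end Summit.PneNP.PneNP.Theorems.HamCompilesKC
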